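import Mathlib
import Summits.Ventures.PercRepro2.Defs
import Summits.Ventures.PercRepro2.CoinTraceBlock
import Summits.Ventures.PercRepro2.CoinTraceShift
import Summits.Ventures.PercRepro2.CoinTraceBlocks
import Summits.Ventures.PercRepro2.CoinTraceBlocks2
import Summits.Ventures.PercRepro2.CoinTwoChainsHard

/-!
# The hard up-set `{C, D, E}` of TWO CHAINS OF LENGTH 2 (blind cell PercRepro2, night-2 g4;
proofs/NIGHT2-DARC.md §24.3)

`H_CD = 𝒩_{wq₂} ⊔ {q₂, q₁q₂} ⊔ 𝒱_{p₂q₂}` with the three-case argument at `B = wq₁q₂`: if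
`T̂_B ≤ 0` the block is the vertex family of `q₂` minus `B`; if `B` lies below both means the
block is the block `{C, E}` (CoinTwoChainsHard.lean) plus the terms of the traces `⊇ B`, all
`≥ 0`; if `B` lies above both means the two non-pivotal traces `⊆ B` are pointwise positive.
-/

namespace Summit.Ventures.PercRepro2.Coin

section TwoChainsHardCD

open Classical

variable {V : Type*} [DecidableEq V] {R : Type*} [Field R] [LinearOrder R] [IsStrictOrderedRing R]

/-- **The hard block `{C, D, E}` of two chains**: the case on the pivotal data at `B = wq₁q₂`;
its «below» case reduces to the block `{C, E}`. -/
theorem twoChains_hardCD_block_nonneg (P : Finset V) {w p₁ p₂ q₁ q₂ : V}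
    (hwP : w ∈ P) (hp₁P : p₁ ∈ P) (hp₂P : p₂ ∈ P) (hq₁P : q₁ ∈ P) (hq₂P : q₂ ∈ P)
    (hPel : ∀ z ∈ P, z = w ∨ z = p₁ ∨ z = p₂ ∨ z = q₁ ∨ z = q₂)
    (hwp₁ : w ≠ p₁) (hwp₂ : w ≠ p₂) (hwq₁ : w ≠ q₁) (hwq₂ : w ≠ q₂) (hp₁₂ : p₁ ≠ p₂)
    (hp₁q₁ : p₁ ≠ q₁) (hp₁q₂ : p₁ ≠ q₂) (hp₂q₁ : p₂ ≠ q₁) (hp₂q₂ : p₂ ≠ q₂) (hq₁₂ : q₁ ≠ q₂)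
    (μ x y xh yh : Finset V → R) (hμ : ∀ Z ∈ P.powerset, 0 ≤ μ Z)
    (hμ0a : ∀ Z ∈ P.powerset, p₁ ∈ Z → p₂ ∉ Z → μ Z = 0)
    (hμ0b : ∀ Z ∈ P.powerset, q₁ ∈ Z → q₂ ∉ Z → μ Z = 0)
    (hμ0c : ∀ Z ∈ P.powerset, w ∈ Z → ¬ (p₁ ∈ Z ∧ p₂ ∈ Z) → ¬ (q₁ ∈ Z ∧ q₂ ∈ Z) → μ Z = 0)
    (hx1 : ∀ Z : Finset V, Z ⊆ P → x Z ≤ 1) (hy1 : ∀ Z : Finset V, Z ⊆ P → y Z ≤ 1)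
    (hxh1 : ∀ Z : Finset V, Z ⊆ P → xh Z ≤ 1) (hyh1 : ∀ Z : Finset V, Z ⊆ P → yh Z ≤ 1)
    (hxanti : ∀ Z Z' : Finset V, Z ⊆ Z' → Z' ⊆ P → x Z' ≤ x Z)
    (hyanti : ∀ Z Z' : Finset V, Z ⊆ Z' → Z' ⊆ P → y Z' ≤ y Z)
    (hxhanti : ∀ Z Z' : Finset V, Z ⊆ Z' → Z' ⊆ P → xh Z' ≤ xh Z)
    (hyhanti : ∀ Z Z' : Finset V, Z ⊆ Z' → Z' ⊆ P → yh Z' ≤ yh Z)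
    (hxh_le : ∀ Z : Finset V, Z ⊆ P → xh Z ≤ x Z) (hyh_le : ∀ Z : Finset V, Z ⊆ P → yh Z ≤ y Z)
    (hxh_eq : ∀ Z : Finset V, Z ⊆ P → w ∉ Z → xh Z = x Z)
    (hyh_eq : ∀ Z : Finset V, Z ⊆ P → w ∉ Z → yh Z = y Z)
    (hPA : TracePA P μ) (hCUp₁ : TraceCUPA P μ p₁) (hCUq₂ : TraceCUPA P μ q₂)
    (hCU : ∀ f₁ f₂ : Finset V → R,
      (∀ Z Z' : Finset V, Z ⊆ Z' → Z' ⊆ P → f₁ Z ≤ f₁ Z') →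
      (∀ Z Z' : Finset V, Z ⊆ Z' → Z' ⊆ P → f₂ Z ≤ f₂ Z') →
      (∀ Z : Finset V, Z ⊆ P → 0 ≤ f₁ Z) → (∀ Z : Finset V, Z ⊆ P → 0 ≤ f₂ Z) →
      (∑ Z ∈ P.powerset.filter (fun Z => p₁ ∈ Z ∧ q₂ ∈ Z), f₁ Z * μ Z) *
          (∑ Z ∈ P.powerset.filter (fun Z => p₁ ∈ Z ∧ q₂ ∈ Z), f₂ Z * μ Z) ≤
        (∑ Z ∈ P.powerset.filter (fun Z => p₁ ∈ Z ∧ q₂ ∈ Z), f₁ Z * f₂ Z * μ Z) *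
          ∑ Z ∈ P.powerset.filter (fun Z => p₁ ∈ Z ∧ q₂ ∈ Z), μ Z)
    (hCU' : ∀ f₁ f₂ : Finset V → R,
      (∀ Z Z' : Finset V, Z ⊆ Z' → Z' ⊆ P → f₁ Z ≤ f₁ Z') →
      (∀ Z Z' : Finset V, Z ⊆ Z' → Z' ⊆ P → f₂ Z ≤ f₂ Z') →
      (∀ Z : Finset V, Z ⊆ P → 0 ≤ f₁ Z) → (∀ Z : Finset V, Z ⊆ P → 0 ≤ f₂ Z) →
      (∑ Z ∈ P.powerset.filter (fun Z => p₂ ∈ Z ∧ q₂ ∈ Z), f₁ Z * μ Z) *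
          (∑ Z ∈ P.powerset.filter (fun Z => p₂ ∈ Z ∧ q₂ ∈ Z), f₂ Z * μ Z) ≤
        (∑ Z ∈ P.powerset.filter (fun Z => p₂ ∈ Z ∧ q₂ ∈ Z), f₁ Z * f₂ Z * μ Z) *
          ∑ Z ∈ P.powerset.filter (fun Z => p₂ ∈ Z ∧ q₂ ∈ Z), μ Z) :
    0 ≤ ∑ Z ∈ P.powerset.filter (fun Z => Disjoint Z {w} ∨ (p₂ ∈ Z ∧ q₂ ∈ Z)),
      μ Z * (xh Z * (∑ Z' ∈ P.powerset, μ Z') - ∑ Z' ∈ P.powerset, x Z' * μ Z') *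
        (yh Z * (∑ Z' ∈ P.powerset, μ Z') - ∑ Z' ∈ P.powerset, y Z' * μ Z') := by
  have hBP : ({w, q₁, q₂} : Finset V) ⊆ P := by
    intro z hz
    simp only [Finset.mem_insert, Finset.mem_singleton] at hz
    rcases hz with rfl | rfl | rfl <;> assumption
  have hwq₂P : ({w, q₂} : Finset V) ⊆ P := by
    intro z hz
    simp only [Finset.mem_insert, Finset.mem_singleton] at hz
    rcases hz with rfl | rfl <;> assumption
  have hHC := twoChains_hard_block_nonneg P hwP hp₁P hp₂P hq₁P hq₂P hPel hwp₁ hwp₂ hwq₁ hwq₂ hp₁₂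
    hp₁q₁ hp₁q₂ hp₂q₁ hp₂q₂ hq₁₂ μ x y xh yh hμ hμ0a hμ0b hμ0c hx1 hy1 hxh1 hyh1 hxanti hyanti
    hxhanti hyhanti hxh_le hyh_le hxh_eq hyh_eq hPA hCUp₁ hCU
  obtain ⟨Λ, hΛ⟩ : ∃ L : R, L = ∑ Z ∈ P.powerset, μ Z := ⟨_, rfl⟩
  obtain ⟨MX, hMX⟩ : ∃ M : R, M = ∑ Z ∈ P.powerset, x Z * μ Z := ⟨_, rfl⟩
  obtain ⟨MY, hMY⟩ : ∃ M : R, M = ∑ Z ∈ P.powerset, y Z * μ Z := ⟨_, rfl⟩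
  have hΛn : 0 ≤ Λ := by rw [hΛ]; exact Finset.sum_nonneg hμ
  rw [← hΛ, ← hMX, ← hMY] at hHC ⊢
  set T : Finset V → R := fun Z => μ Z * (xh Z * Λ - MX) * (yh Z * Λ - MY) with hTdef
  show 0 ≤ ∑ Z ∈ P.powerset.filter (fun Z => Disjoint Z {w} ∨ (p₂ ∈ Z ∧ q₂ ∈ Z)), T Z
  have hV₂ : 0 ≤ ∑ Z ∈ P.powerset.filter (fun Z => Disjoint Z {w} ∨ q₂ ∈ Z), T Z := by
    have h := cylinder_block_nonneg P hwP hq₂P μ x y xh yh hμ hx1 hy1 hxh1 hyh1 hxanti hyanti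
      hxhanti hyhanti hxh_le hyh_le hxh_eq hyh_eq hPA hCUq₂
    rw [← hΛ, ← hMX, ← hMY] at h
    exact h
  have hAv : 0 ≤ ∑ Z ∈ P.powerset.filter (fun Z => Disjoint Z {w, q₂}), T Z := by
    have h := avoidU_block_nonneg P {w, q₂} (by simp) hwq₂P μ x y xh yh hμ hx1 hy1 hxh1 hyh1
      hxanti hyanti hxhanti hyhanti hxh_eq hyh_eq hPA
    rw [← hΛ, ← hMX, ← hMY] at h
    exact h
  have hCyl : 0 ≤ ∑ Z ∈ P.powerset.filter (fun Z => p₂ ∈ Z ∧ q₂ ∈ Z), T Z := by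
    have h := cylinder₂_block_nonneg P μ x y xh yh hμ hx1 hy1 hxh1 hyh1 hxanti hyanti hxhanti
      hyhanti hxh_le hyh_le hPA hCU'
    rw [← hΛ, ← hMX, ← hMY] at h
    exact h
  -- the pivotal data at `B = {w, q₁, q₂}`
  set B : Finset V := {w, q₁, q₂} with hBdef
  have hBpow : B ∈ P.powerset := Finset.mem_powerset.mpr hBP
  have hμB : 0 ≤ μ B := hμ B hBpow
  -- a trace with `w, q₂ ∈ Z`, `p₂ ∉ Z` and positive mass is `B`
  have hisB : ∀ Z ∈ P.powerset, w ∈ Z → q₂ ∈ Z → p₂ ∉ Z → μ Z ≠ 0 → Z = B := by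
    intro Z hZpow hwZ hq₂Z hp₂Z hμZ
    have hZP : Z ⊆ P := Finset.mem_powerset.mp hZpow
    have hp₁Z : p₁ ∉ Z := fun h => hμZ (hμ0a Z hZpow h hp₂Z)
    have hq₁Z : q₁ ∈ Z := by
      by_contra h
      exact hμZ (hμ0c Z hZpow hwZ (fun h' => hp₁Z h'.1) (fun h' => h h'.1))
    apply Finset.Subset.antisymm
    · intro z hz
      rcases hPel z (hZP hz) with rfl | rfl | rfl | rfl | rfl
      · simp [hBdef]
      · exact absurd hz hp₁Z
      · exact absurd hz hp₂Z
      · simp [hBdef]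
      · simp [hBdef]
    · intro z hz
      simp only [hBdef, Finset.mem_insert, Finset.mem_singleton] at hz
      rcases hz with rfl | rfl | rfl
      · exact hwZ
      · exact hq₁Z
      · exact hq₂Z
  by_cases hTB : (xh B * Λ - MX) * (yh B * Λ - MY) ≤ 0
  · -- CASE 1: `T̂_B ≤ 0`: `G(H_CD) = G(𝒩_w ∪ 𝒱_{q₂}) − (terms at w, q₂ ∈ Z, p₂ ∉ Z)`
    have hsplit := Finset.sum_filter_add_sum_filter_not
      (P.powerset.filter (fun Z => Disjoint Z {w} ∨ q₂ ∈ Z)) (fun Z => p₂ ∈ Z ∨ Disjoint Z {w}) T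
    have e1 : (P.powerset.filter (fun Z => Disjoint Z {w} ∨ q₂ ∈ Z)).filter
        (fun Z => p₂ ∈ Z ∨ Disjoint Z {w}) =
        P.powerset.filter (fun Z => Disjoint Z {w} ∨ (p₂ ∈ Z ∧ q₂ ∈ Z)) := by
      rw [Finset.filter_filter]
      refine Finset.filter_congr fun Z _ => ?_
      constructor
      · rintro ⟨h1 | h1, h2 | h2⟩
        · exact Or.inl h1
        · exact Or.inl h2
        · exact Or.inr ⟨h2, h1⟩
        · exact Or.inl h2
      · rintro (h | ⟨h1, h2⟩)
        · exact ⟨Or.inl h, Or.inr h⟩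
        · exact ⟨Or.inr h2, Or.inl h1⟩
    rw [e1] at hsplit
    have hrest : ∑ Z ∈ (P.powerset.filter (fun Z => Disjoint Z {w} ∨ q₂ ∈ Z)).filter
        (fun Z => ¬ (p₂ ∈ Z ∨ Disjoint Z {w})), T Z ≤ 0 := by
      refine Finset.sum_nonpos fun Z hZ => ?_
      rw [Finset.mem_filter, Finset.mem_filter] at hZ
      obtain ⟨⟨hZpow, hZ1⟩, hZ2⟩ := hZ
      have hp₂Z : p₂ ∉ Z := fun h => hZ2 (Or.inl h)
      have hwZ : w ∈ Z := by
        by_contra hw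
        exact hZ2 (Or.inr (Finset.disjoint_singleton_right.mpr hw))
      have hq₂Z : q₂ ∈ Z := by
        rcases hZ1 with h | h
        · exact absurd (Finset.disjoint_singleton_right.mp h) (fun h' => h' hwZ)
        · exact h
      by_cases hμZ : μ Z = 0
      · show μ Z * (xh Z * Λ - MX) * (yh Z * Λ - MY) ≤ 0
        rw [hμZ]; simp
      · have hZB := hisB Z hZpow hwZ hq₂Z hp₂Z hμZ
        show μ Z * (xh Z * Λ - MX) * (yh Z * Λ - MY) ≤ 0
        rw [hZB, mul_assoc]
        exact mul_nonpos_of_nonneg_of_nonpos hμB hTB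
    linarith [hsplit, hV₂, hrest]
  · have hTBpos : 0 < (xh B * Λ - MX) * (yh B * Λ - MY) := lt_of_not_ge hTB
    rcases pos_and_pos_or_neg_and_neg_of_mul_pos hTBpos with ⟨hxB, hyB⟩ | ⟨hxB, hyB⟩
    · -- CASE 3: `B` above both means: `H_CD = 𝒩_{wq₂} ⊔ {Z ∌ w : q₂ ∈ Z, p₂ ∉ Z} ⊔ 𝒱_{p₂q₂}`
      have hsplit := Finset.sum_filter_add_sum_filter_not
        (P.powerset.filter (fun Z => Disjoint Z {w} ∨ (p₂ ∈ Z ∧ q₂ ∈ Z)))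
        (fun Z => Disjoint Z {w, q₂}) T
      have e1 : (P.powerset.filter (fun Z => Disjoint Z {w} ∨ (p₂ ∈ Z ∧ q₂ ∈ Z))).filter
          (fun Z => Disjoint Z {w, q₂}) = P.powerset.filter (fun Z => Disjoint Z {w, q₂}) := by
        rw [Finset.filter_filter]
        refine Finset.filter_congr fun Z _ => ?_
        constructor
        · exact fun h => h.2
        · intro h
          exact ⟨Or.inl (Finset.disjoint_of_subset_right (by simp) h), h⟩
      have hsplit2 := Finset.sum_filter_add_sum_filter_not
        ((P.powerset.filter (fun Z => Disjoint Z {w} ∨ (p₂ ∈ Z ∧ q₂ ∈ Z))).filter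
          (fun Z => ¬ Disjoint Z {w, q₂})) (fun Z => p₂ ∈ Z ∧ q₂ ∈ Z) T
      have e2 : ((P.powerset.filter (fun Z => Disjoint Z {w} ∨ (p₂ ∈ Z ∧ q₂ ∈ Z))).filter
          (fun Z => ¬ Disjoint Z {w, q₂})).filter (fun Z => p₂ ∈ Z ∧ q₂ ∈ Z) =
          P.powerset.filter (fun Z => p₂ ∈ Z ∧ q₂ ∈ Z) := by
        rw [Finset.filter_filter, Finset.filter_filter]
        refine Finset.filter_congr fun Z _ => ?_
        constructor
        · exact fun h => h.2.2
        · intro h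
          refine ⟨Or.inr h, ?_, h⟩
          intro hd
          exact (Finset.disjoint_left.mp hd h.2) (by simp)
      rw [e2] at hsplit2
      rw [e1] at hsplit
      have hmid : 0 ≤ ∑ Z ∈ ((P.powerset.filter (fun Z => Disjoint Z {w} ∨ (p₂ ∈ Z ∧ q₂ ∈ Z))).filter
          (fun Z => ¬ Disjoint Z {w, q₂})).filter (fun Z => ¬ (p₂ ∈ Z ∧ q₂ ∈ Z)), T Z := by
        refine Finset.sum_nonneg fun Z hZ => ?_
        rw [Finset.mem_filter, Finset.mem_filter, Finset.mem_filter] at hZ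
        obtain ⟨⟨⟨hZpow, hZ1⟩, hZ2⟩, hZ3⟩ := hZ
        have hwZ : w ∉ Z := by
          rcases hZ1 with h | h
          · exact Finset.disjoint_singleton_right.mp h
          · exact absurd h hZ3
        have hq₂Z : q₂ ∈ Z := by
          by_contra h
          exact hZ2 (Finset.disjoint_insert_right.mpr
            ⟨hwZ, Finset.disjoint_singleton_right.mpr h⟩)
        have hp₂Z : p₂ ∉ Z := fun h => hZ3 ⟨h, hq₂Z⟩
        have hZP : Z ⊆ P := Finset.mem_powerset.mp hZpow
        by_cases hμZ : μ Z = 0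
        · show 0 ≤ μ Z * (xh Z * Λ - MX) * (yh Z * Λ - MY)
          rw [hμZ]; simp
        · have hp₁Z : p₁ ∉ Z := fun h => hμZ (hμ0a Z hZpow h hp₂Z)
          have hZB : Z ⊆ B := by
            intro z hz
            rcases hPel z (hZP hz) with rfl | rfl | rfl | rfl | rfl
            · exact absurd hz hwZ
            · exact absurd hz hp₁Z
            · exact absurd hz hp₂Z
            · simp [hBdef]
            · simp [hBdef]
          have hxZ : xh B * Λ - MX ≤ xh Z * Λ - MX := by
            rw [hxh_eq Z hZP hwZ]
            have h1 : x B ≤ x Z := hxanti Z B hZB hBP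
            have h2 : xh B ≤ x B := hxh_le B hBP
            nlinarith [mul_le_mul_of_nonneg_right (h2.trans h1) hΛn]
          have hyZ : yh B * Λ - MY ≤ yh Z * Λ - MY := by
            rw [hyh_eq Z hZP hwZ]
            have h1 : y B ≤ y Z := hyanti Z B hZB hBP
            have h2 : yh B ≤ y B := hyh_le B hBP
            nlinarith [mul_le_mul_of_nonneg_right (h2.trans h1) hΛn]
          show 0 ≤ μ Z * (xh Z * Λ - MX) * (yh Z * Λ - MY)
          rw [mul_assoc]
          exact mul_nonneg (hμ Z hZpow) (mul_nonneg (by linarith) (by linarith))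
      linarith [hsplit, hsplit2, hAv, hCyl, hmid]
    · -- CASE 2: `B` below both means: `H_CD = H_C ⊔ {w, p₂, q₂ ∈ Z, p₁ ∉ Z}` up to phantoms,
      -- and the extra terms are `≥ 0` since those traces contain `B`
      have hcongr : ∑ Z ∈ P.powerset.filter (fun Z => Disjoint Z {w} ∨ (p₂ ∈ Z ∧ q₂ ∈ Z)), T Z =
          ∑ Z ∈ P.powerset.filter (fun Z => (Disjoint Z {w} ∨ (p₁ ∈ Z ∧ q₂ ∈ Z)) ∨
            (w ∈ Z ∧ p₂ ∈ Z ∧ q₂ ∈ Z ∧ p₁ ∉ Z)), T Z := by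
        refine sum_filter_congr_of_ne_zero _ T _ _ fun Z hZ hT => ?_
        have hμZ : μ Z ≠ 0 := by
          intro h0
          apply hT
          show μ Z * (xh Z * Λ - MX) * (yh Z * Λ - MY) = 0
          rw [h0]; simp
        constructor
        · rintro (h | ⟨hp₂Z, hq₂Z⟩)
          · exact Or.inl (Or.inl h)
          · by_cases hp₁Z : p₁ ∈ Z
            · exact Or.inl (Or.inr ⟨hp₁Z, hq₂Z⟩)
            · by_cases hwZ : w ∈ Z
              · exact Or.inr ⟨hwZ, hp₂Z, hq₂Z, hp₁Z⟩
              · exact Or.inl (Or.inl (Finset.disjoint_singleton_right.mpr hwZ))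
        · rintro ((h | ⟨hp₁Z, hq₂Z⟩) | ⟨_, hp₂Z, hq₂Z, _⟩)
          · exact Or.inl h
          · have hp₂Z : p₂ ∈ Z := by
              by_contra h; exact hμZ (hμ0a Z hZ hp₁Z h)
            exact Or.inr ⟨hp₂Z, hq₂Z⟩
          · exact Or.inr ⟨hp₂Z, hq₂Z⟩
      have hsplit := Finset.sum_filter_add_sum_filter_not
        (P.powerset.filter (fun Z => (Disjoint Z {w} ∨ (p₁ ∈ Z ∧ q₂ ∈ Z)) ∨
          (w ∈ Z ∧ p₂ ∈ Z ∧ q₂ ∈ Z ∧ p₁ ∉ Z)))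
        (fun Z => Disjoint Z {w} ∨ (p₁ ∈ Z ∧ q₂ ∈ Z)) T
      have e1 : (P.powerset.filter (fun Z => (Disjoint Z {w} ∨ (p₁ ∈ Z ∧ q₂ ∈ Z)) ∨
          (w ∈ Z ∧ p₂ ∈ Z ∧ q₂ ∈ Z ∧ p₁ ∉ Z))).filter (fun Z => Disjoint Z {w} ∨ (p₁ ∈ Z ∧ q₂ ∈ Z)) =
          P.powerset.filter (fun Z => Disjoint Z {w} ∨ (p₁ ∈ Z ∧ q₂ ∈ Z)) := by
        rw [Finset.filter_filter]
        refine Finset.filter_congr fun Z _ => ?_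
        constructor
        · exact fun h => h.2
        · exact fun h => ⟨Or.inl h, h⟩
      rw [e1] at hsplit
      have hrest : 0 ≤ ∑ Z ∈ (P.powerset.filter (fun Z => (Disjoint Z {w} ∨ (p₁ ∈ Z ∧ q₂ ∈ Z)) ∨
          (w ∈ Z ∧ p₂ ∈ Z ∧ q₂ ∈ Z ∧ p₁ ∉ Z))).filter
          (fun Z => ¬ (Disjoint Z {w} ∨ (p₁ ∈ Z ∧ q₂ ∈ Z))), T Z := by
        refine Finset.sum_nonneg fun Z hZ => ?_
        rw [Finset.mem_filter, Finset.mem_filter] at hZ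
        obtain ⟨⟨hZpow, hZ1⟩, hZ2⟩ := hZ
        have hZP : Z ⊆ P := Finset.mem_powerset.mp hZpow
        rcases hZ1 with h | ⟨hwZ, hp₂Z, hq₂Z, hp₁Z⟩
        · exact absurd h hZ2
        by_cases hμZ : μ Z = 0
        · show 0 ≤ μ Z * (xh Z * Λ - MX) * (yh Z * Λ - MY)
          rw [hμZ]; simp
        · have hq₁Z : q₁ ∈ Z := by
            by_contra h
            exact hμZ (hμ0c Z hZpow hwZ (fun h' => hp₁Z h'.1) (fun h' => h h'.1))
          have hBZ : B ⊆ Z := by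
            intro z hz
            simp only [hBdef, Finset.mem_insert, Finset.mem_singleton] at hz
            rcases hz with rfl | rfl | rfl
            · exact hwZ
            · exact hq₁Z
            · exact hq₂Z
          have hxZ : xh Z * Λ - MX ≤ xh B * Λ - MX := by
            have h1 : xh Z ≤ xh B := hxhanti B Z hBZ hZP
            nlinarith [mul_le_mul_of_nonneg_right h1 hΛn]
          have hyZ : yh Z * Λ - MY ≤ yh B * Λ - MY := by
            have h1 : yh Z ≤ yh B := hyhanti B Z hBZ hZP
            nlinarith [mul_le_mul_of_nonneg_right h1 hΛn]
          show 0 ≤ μ Z * (xh Z * Λ - MX) * (yh Z * Λ - MY)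
          rw [mul_assoc]
          exact mul_nonneg (hμ Z hZpow)
            (mul_nonneg_of_nonpos_of_nonpos (by linarith) (by linarith))
      rw [hcongr]
      linarith [hsplit, hHC, hrest]

end TwoChainsHardCD

end Summit.Ventures.PercRepro2.Coin
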